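import Mathlib
import HarnessLib
import Summits.HubbardSuperconductivity.HubbardSuperconductivity.Theorems.KLProgrammeKLRegimeFatMultiplierIncrementPairSpace
import Summits.HubbardSuperconductivity.HubbardSuperconductivity.Theorems.KLProgrammeKLRegimeFatMultiplierIncrementPairSymbol
import Summits.HubbardSuperconductivity.HubbardSuperconductivity.Theorems.KLProgrammeKLRegimeFatMultiplierIncrementRelJetsScale
import Summits.HubbardSuperconductivity.HubbardSuperconductivity.Theorems.KLProgrammeKLRegimeFatFrameInstance
import Literature.MathematicalPhysics.QuantumLattice.AngularCutoffFrechetBounds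
import Summits.HubbardSuperconductivity.HubbardSuperconductivity.Theorems.KLProgrammeKLRegimeSectorSliceIncrRates

/-!
# Route `KLProgramme` — crux K3 ENGINE (stmt-HubbardSuperconductivity-20437) stub (b) conj. 2 «(c-D)² FAMILY TELESCOPE», brick (D5b, iso): the fat
# INCREMENT pair `(F̃^{K_o}_ω − F̃^K_ω)·F̃^K_{ω′}` has space differences in RELATIVE SCALE FORM along every admissible integer step

Cell `gate-hubbard-kl`, seat hubbard-kl-k3c3-p2 (g11); F1-DESIGN §10.  `norm_fwdDiff_iter_space_fatIncrPair_le` (p585208, exact Leibniz brackets at the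
step's own norms, isotropic first slot `(4+2A)‖w‖`) ∘ `incrPair_cofactor_scale_le` ∘ `incrPair_space_rel_scale_le` (`…IncrementRelJetsScale{Data,}`):
in the two-scale class of a flow piece at depth `x ≥ 1` (`|ν| ≤ G₀/x²`, `‖Dν‖ ≤ G₁/x`, `‖D²ν‖ ≤ G₂`, `‖D³ν‖ ≤ G₃x`, `4 + 8A₃ ≤ ε₃₀ + ε₃₁x`,
`G₀/x² ≤ Λ_m`), with `η = ‖toLp w‖` the Euclidean step norm,

* **`norm_fwdDiff_iter_fatIncrPair_scaleIso_le`** — `‖Δ_u^k Gs^Δ(q)‖ ≤ 𝔅₀(x)·η^k·(r̃_{k0} + … + r̃_{kk}x^k)`, `k = 1, 2, 3`,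
  `𝔅₀(x) = C₁·(G₀/x²)(2(Λ_m + G₀/x²) + G₀/x²)`, coefficients nested-explicit (abbreviation hypotheses; iso slot `t = 4 + 2A`, angular size
  `ζ = 1 + 6/w_{m+1}`, neighbour count `9`), all nonnegative.

Everything is proved; no definitions, no sorry.  Nothing asserts superconductivity. [cite: BenfattoGiulianiMastropietro2006, §2.5 Lemma 2.2 (2.53)–(2.55), §3 (3.2)–(3.8)]
-/

noncomputable section

namespace Summit.HubbardSuperconductivity.HubbardSuperconductivity.Theorems.TorusFourierL2

set_option linter.dupNamespace false -- summit = problem name (single-conjunct summit), D-0017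

open Set Finset Filter Topology Literature.MathematicalPhysics.QuantumLattice Literature.MathematicalPhysics.QuantumLattice.BandSectorCounting
open Literature.MathematicalPhysics.QuantumLattice.FermiRG Literature.Probability.LatticeModels Literature.Analysis.SpecialFunctions Literature.Analysis.Calculus
open Summit.HubbardSuperconductivity.HubbardSuperconductivity.Theorems.DispersionFlow
open Summit.HubbardSuperconductivity.HubbardSuperconductivity.Theorems.KLRegimeSplit
open Summit.HubbardSuperconductivity.HubbardSuperconductivity.Theorems.KLProgrammeLegKernels
open Summit.HubbardSuperconductivity.HubbardSuperconductivity.Theorems.PerturbedFermiCurve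
open scoped Real Nat

section IsoScale

open Classical

variable {L M : ℕ} [NeZero L] [NeZero M] {K : TrigPolyC4v} (Ko : TrigPolyC4v) {A A₃ : ℝ}
  (hA : ∀ p : Momentum, ∀ j ≤ 2, ‖iteratedFDeriv ℝ j (frameShift K) p‖ ≤ A) (hA3 : ∀ p : Momentum, ‖iteratedFDeriv ℝ 3 (frameShift K) p‖ ≤ A₃)
  {μ e₀ z β : ℝ} (he : 0 < e₀) (hz : 0 < z) (hz1 : z ≤ 1) (hgap : e₀ + A + z ^ 2 < -μ) (h3 : e₀ + A - μ ≤ 3)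
  (m : ℕ)
  {d : ℝ} (hd1 : ∀ u, |deriv (bgmCutoffSq e₀) u| ≤ d) (hd2 : ∀ u, |iteratedDeriv 2 (bgmCutoffSq e₀) u| ≤ d)
  (hd3 : ∀ u, |iteratedDeriv 3 (bgmCutoffSq e₀) u| ≤ d) (hd4 : ∀ u, |iteratedDeriv 4 (bgmCutoffSq e₀) u| ≤ d)
  {Ba : ℝ} (hB0 : 0 ≤ Ba)
  (hB : ∀ (i : ℕ), i ≤ 3 → ∀ (n : ℕ) (ω : ℤ) (θ₀ : ℝ) (q w : Fin 2 → ℝ) (t : ℝ) {r₀ : ℝ}, 0 < r₀ →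
    r₀ ≤ ‖momToComplex (q + t • w)‖ → |sectorRelAngle θ₀ (q + t • w)| < π →
    ‖iteratedDeriv i (fun t : ℝ => sectorWeightCirc n ω (polarAngle (q + t • w))) t‖ ≤
      (3 : ℕ)! * Ba * ((1 + (sectorWidth n)⁻¹ * (3 : ℕ)!) * ‖momToComplex w‖ / r₀) ^ i)
  -- the piece `ν = e_K − e_{K_o}` in the two-scale class at depth `x`
  {ν : (Fin 2 → ℝ) → ℝ} (hν : ∀ p, ν p = frameLevel μ K (WithLp.toLp 2 p) - frameLevel μ Ko (WithLp.toLp 2 p)) (hνs : ContDiff ℝ 3 ν)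
  {x G₀ G₁ G₂ G₃ ε₃₀ ε₃₁ : ℝ} (hx : 1 ≤ x) (hG₀ : 0 < G₀) (hG₁ : 0 ≤ G₁) (hG₂ : 0 ≤ G₂) (hG₃ : 0 ≤ G₃) (hε₃₀ : 0 ≤ ε₃₀) (hε₃₁ : 0 ≤ ε₃₁)
  (hN₀ : ∀ p, |ν p| ≤ G₀ / x ^ 2) (hN₁ : ∀ p, ‖fderiv ℝ ν p‖ ≤ G₁ / x) (hN₂ : ∀ p, ‖iteratedFDeriv ℝ 2 ν p‖ ≤ G₂)
  (hN₃ : ∀ p, ‖iteratedFDeriv ℝ 3 ν p‖ ≤ G₃ * x) (hGΛ : G₀ / x ^ 2 ≤ klScale e₀ m) (hA₃x : 4 + 8 * A₃ ≤ ε₃₀ + ε₃₁ * x)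
  -- the names (instantiate with `rfl`)
  {κ C₁ B₀x t ε₂ ζ 𝔮₁ 𝔮₂ 𝔮₃₀ 𝔮₃₁ d₁ w₁ d₂ w₂ d₃₀ d₃₁ w₃₀ w₃₁ o₁₀ o₁₁ o₂₀ o₂₁ o₂₂ o₃₀ o₃₁ o₃₂ o₃₃
    R₁₀ R₁₁ R₂₀ R₂₁ R₂₂ R₃₀ R₃₁ R₃₂ R₃₃ r₁₀ r₁₁ r₂₀ r₂₁ r₂₂ r₃₀ r₃₁ r₃₂ r₃₃ : ℝ}
  (hκ : κ = e₀ ^ 2 / klScale e₀ m ^ 2) (hC₁ : C₁ = d * e₀ ^ 2 / klScale e₀ m ^ 2)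
  (hB₀x : B₀x = C₁ * (G₀ / x ^ 2 * (2 * (klScale e₀ m + G₀ / x ^ 2) + G₀ / x ^ 2)))
  (ht : t = 4 + 2 * A) (hε₂ : ε₂ = 4 + 4 * A) (hζ : ζ = 1 + 6 * (sectorWidth (m + 1))⁻¹)
  (h𝔮₁ : 𝔮₁ = 2 * (d * e₀ ^ 2) * t / klScale e₀ m + 9 * (12 * Ba * ζ))
  (h𝔮₂ : 𝔮₂ = (4 * (d * e₀ ^ 4) + 2 * (d * e₀ ^ 2)) * t ^ 2 / klScale e₀ m ^ 2 + 2 * (d * e₀ ^ 2) * (4 + 4 * A) / klScale e₀ m +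
    4 * (d * e₀ ^ 2) * t / klScale e₀ m * (9 * (12 * Ba * ζ)) + 9 * ((12 * Ba + 72 * Ba ^ 2) * ζ ^ 2))
  (h𝔮₃₀ : 𝔮₃₀ = (8 * (d * e₀ ^ 6) + 12 * (d * e₀ ^ 4)) * t ^ 3 / klScale e₀ m ^ 3 + (12 * (d * e₀ ^ 4) + 6 * (d * e₀ ^ 2)) * (t * (4 + 4 * A)) / klScale e₀ m ^ 2 +
    2 * (d * e₀ ^ 2) * ε₃₀ / klScale e₀ m +
    3 * (((4 * (d * e₀ ^ 4) + 2 * (d * e₀ ^ 2)) * t ^ 2 / klScale e₀ m ^ 2 + 2 * (d * e₀ ^ 2) * (4 + 4 * A) / klScale e₀ m) * (9 * (12 * Ba * ζ))) +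
    3 * (2 * (d * e₀ ^ 2) * t / klScale e₀ m * (9 * ((12 * Ba + 72 * Ba ^ 2) * ζ ^ 2))) + 9 * ((12 * Ba + 216 * Ba ^ 2) * ζ ^ 3))
  (h𝔮₃₁ : 𝔮₃₁ = 2 * (d * e₀ ^ 2) * ε₃₁ / klScale e₀ m)
  (hd₁ : d₁ = 4 * klScale e₀ m * t) (hw₁ : w₁ = 2 * (t * G₀ + 2 * klScale e₀ m * G₁ + G₀ * G₁)) (hd₂ : d₂ = 2 * (t ^ 2 + 2 * klScale e₀ m * ε₂))
  (hw₂ : w₂ = 2 * (ε₂ * G₀ + 2 * t * G₁ + 2 * klScale e₀ m * G₂ + G₁ ^ 2 + G₀ * G₂))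
  (hd₃₀ : d₃₀ = 2 * (3 * t * ε₂ + 2 * klScale e₀ m * ε₃₀)) (hd₃₁ : d₃₁ = 4 * klScale e₀ m * ε₃₁)
  (hw₃₀ : w₃₀ = 2 * (ε₃₀ * G₀ + ε₃₁ * G₀ + 3 * ε₂ * G₁ + 3 * t * G₂ + 3 * G₁ * G₂ + G₀ * G₃)) (hw₃₁ : w₃₁ = 4 * klScale e₀ m * G₃)
  (ho₁₀ : o₁₀ = t / klScale e₀ m) (ho₁₁ : o₁₁ = 2 * G₁ / G₀) (ho₂₀ : o₂₀ = ε₂ / klScale e₀ m + G₁ ^ 2 / (klScale e₀ m * G₀))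
  (ho₂₁ : o₂₁ = 2 * t * G₁ / (klScale e₀ m * G₀)) (ho₂₂ : o₂₂ = 2 * G₂ / G₀)
  (ho₃₀ : o₃₀ = ε₃₀ / klScale e₀ m) (ho₃₁ : o₃₁ = ε₃₁ / klScale e₀ m + 3 * ε₂ * G₁ / (klScale e₀ m * G₀) + 3 * G₁ * G₂ / (klScale e₀ m * G₀))
  (ho₃₂ : o₃₂ = 3 * t * G₂ / (klScale e₀ m * G₀)) (ho₃₃ : o₃₃ = 2 * G₃ / G₀)
  (hR₁₀ : R₁₀ = κ * (d₁ + w₁) + o₁₀) (hR₁₁ : R₁₁ = o₁₁)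
  (hR₂₀ : R₂₀ = κ ^ 2 * (d₁ + w₁) ^ 2 + κ * (o₁₀ * (2 * d₁ + w₁)) + κ * (d₂ + w₂) + o₂₀) (hR₂₁ : R₂₁ = κ * (o₁₁ * (2 * d₁ + w₁)) + o₂₁)
  (hR₂₂ : R₂₂ = o₂₂)
  (hR₃₀ : R₃₀ = κ ^ 3 * (d₁ + w₁) ^ 3 + κ ^ 2 * (o₁₀ * (3 * d₁ ^ 2 + 3 * d₁ * w₁ + w₁ ^ 2)) +
    3 * (κ ^ 2 * ((d₁ + w₁) * (d₂ + w₂)) + κ * (d₁ * o₂₀ + o₁₀ * d₂ + o₁₀ * w₂)) + κ * (d₃₀ + w₃₀) + o₃₀)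
  (hR₃₁ : R₃₁ = κ ^ 2 * (o₁₁ * (3 * d₁ ^ 2 + 3 * d₁ * w₁ + w₁ ^ 2)) + 3 * (κ * (d₁ * o₂₁ + o₁₁ * d₂ + o₁₁ * w₂)) + κ * (d₃₁ + w₃₁) + o₃₁)
  (hR₃₂ : R₃₂ = 3 * (κ * (d₁ * o₂₂)) + o₃₂) (hR₃₃ : R₃₃ = o₃₃)
  (hr₁₀ : r₁₀ = R₁₀ + 𝔮₁) (hr₁₁ : r₁₁ = R₁₁) (hr₂₀ : r₂₀ = R₂₀ + 2 * R₁₀ * 𝔮₁ + 𝔮₂) (hr₂₁ : r₂₁ = R₂₁ + 2 * R₁₁ * 𝔮₁) (hr₂₂ : r₂₂ = R₂₂)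
  (hr₃₀ : r₃₀ = R₃₀ + 3 * R₂₀ * 𝔮₁ + 3 * R₁₀ * 𝔮₂ + 𝔮₃₀) (hr₃₁ : r₃₁ = R₃₁ + 3 * R₂₁ * 𝔮₁ + 3 * R₁₁ * 𝔮₂ + 𝔮₃₁)
  (hr₃₂ : r₃₂ = R₃₂ + 3 * R₂₂ * 𝔮₁) (hr₃₃ : r₃₃ = R₃₃)

include hA hA3 he hz hz1 hgap h3 hd1 hd2 hd3 hd4 hB0 hB hν hνs hx hG₀ hG₁ hG₂ hG₃ hε₃₀ hε₃₁ hN₀ hN₁ hN₂ hN₃ hGΛ hA₃x hκ hC₁ hB₀x ht hε₂ hζ h𝔮₁ h𝔮₂ h𝔮₃₀ h𝔮₃₁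
  hd₁ hw₁ hd₂ hw₂ hd₃₀ hd₃₁ hw₃₀ hw₃₁ ho₁₀ ho₁₁ ho₂₀ ho₂₁ ho₂₂ ho₃₀ ho₃₁ ho₃₂ ho₃₃ hR₁₀ hR₁₁ hR₂₀ hR₂₁ hR₂₂ hR₃₀ hR₃₁ hR₃₂ hR₃₃
  hr₁₀ hr₁₁ hr₂₀ hr₂₁ hr₂₂ hr₃₀ hr₃₁ hr₃₂ hr₃₃ in
set_option maxHeartbeats 4000000 in
/-- **Space differences of the fat increment pair in relative scale form, every admissible integer step** (see the module docstring).
[cite: BenfattoGiulianiMastropietro2006, §2.5 Lemma 2.2 (2.53)–(2.55), §3 (3.2)–(3.8)] -/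
theorem norm_fwdDiff_iter_fatIncrPair_scaleIso_le (ω ω' : Fin (sectorCount (m + 1))) (Gs : TorusSite 1 (2 * M) × TorusSite 2 L → ℂ)
    (hGsdef : Gs = fun q => bgmFatMultiplier L M e₀ β (nambuXiCT L μ Ko) (m + 1) ω (⟨(q.1 0).val, ZMod.val_lt (q.1 0)⟩, q.2) *
        bgmFatMultiplier L M e₀ β (nambuXiCT L μ K) (m + 1) ω' (⟨(q.1 0).val, ZMod.val_lt (q.1 0)⟩, q.2) -
      bgmFatMultiplier L M e₀ β (nambuXiCT L μ K) (m + 1) ω (⟨(q.1 0).val, ZMod.val_lt (q.1 0)⟩, q.2) *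
        bgmFatMultiplier L M e₀ β (nambuXiCT L μ K) (m + 1) ω' (⟨(q.1 0).val, ZMod.val_lt (q.1 0)⟩, q.2))
    (u : Fin 2 → ℤ) (hu : ∀ j, 3 * |2 * π / L| * |(u j : ℝ)| ≤ z) (q : TorusSite 1 (2 * M) × TorusSite 2 L) :
    ‖(fwdDiff ((0 : TorusSite 1 (2 * M)), (fun j => ((u j : ℤ) : ZMod L)))) Gs q‖ ≤
        B₀x * (‖(WithLp.toLp 2 (fun j => 2 * π / L * (u j : ℝ)) : EuclideanSpace ℝ (Fin 2))‖ * (r₁₀ + r₁₁ * x)) ∧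
    ‖((fwdDiff ((0 : TorusSite 1 (2 * M)), (fun j => ((u j : ℤ) : ZMod L))))^[2] Gs) q‖ ≤
        B₀x * (‖(WithLp.toLp 2 (fun j => 2 * π / L * (u j : ℝ)) : EuclideanSpace ℝ (Fin 2))‖ ^ 2 * (r₂₀ + r₂₁ * x + r₂₂ * x ^ 2)) ∧
    ‖((fwdDiff ((0 : TorusSite 1 (2 * M)), (fun j => ((u j : ℤ) : ZMod L))))^[3] Gs) q‖ ≤
        B₀x * (‖(WithLp.toLp 2 (fun j => 2 * π / L * (u j : ℝ)) : EuclideanSpace ℝ (Fin 2))‖ ^ 3 * (r₃₀ + r₃₁ * x + r₃₂ * x ^ 2 + r₃₃ * x ^ 3)) ∧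
    (0 ≤ r₁₀ ∧ 0 ≤ r₁₁ ∧ 0 ≤ r₂₀ ∧ 0 ≤ r₂₁ ∧ 0 ≤ r₂₂ ∧ 0 ≤ r₃₀ ∧ 0 ≤ r₃₁ ∧ 0 ≤ r₃₂ ∧ 0 ≤ r₃₃) := by
  have hL : (0 : ℝ) < L := Nat.cast_pos.2 (Nat.pos_of_ne_zero (NeZero.ne L))
  have hπ := Real.pi_pos
  have hΛ : 0 < klScale e₀ m := by rw [klScale]; positivity
  have hA0 : 0 ≤ A := (norm_nonneg _).trans (hA 0 0 (by norm_num))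
  have hd0 : 0 ≤ d := (abs_nonneg _).trans (hd1 0)
  have hx0 : 0 < x := lt_of_lt_of_le one_pos hx
  -- the objects: neighbour sets, angular factor, increment symbol, identification
  obtain ⟨S₁, hS₁⟩ : ∃ S₁ : Finset ℕ, S₁ = (range (sectorCount (m + 1))).filter
      (fun ω₁ : ℕ => ∃ δ : ℤ, |δ| ≤ 1 ∧ (sectorCount (m + 1) : ℤ) ∣ ((ω₁ : ℤ) - ((ω : ℕ) : ℤ) - δ)) := ⟨_, rfl⟩
  obtain ⟨S₂, hS₂⟩ : ∃ S₂ : Finset ℕ, S₂ = (range (sectorCount (m + 1))).filter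
      (fun ω₁ : ℕ => ∃ δ : ℤ, |δ| ≤ 1 ∧ (sectorCount (m + 1) : ℤ) ∣ ((ω₁ : ℤ) - ((ω' : ℕ) : ℤ) - δ)) := ⟨_, rfl⟩
  have hS₁r : S₁ ⊆ range (sectorCount (m + 1)) := by rw [hS₁]; exact fatNbr_subset_range (m + 1) ω
  have hS₂r : S₂ ⊆ range (sectorCount (m + 1)) := by rw [hS₂]; exact fatNbr_subset_range (m + 1) ω'
  have hS9 : (S₁.card * S₂.card : ℝ) ≤ 9 := by
    have h1 : S₁.card ≤ 3 := by rw [hS₁]; exact card_fatNbr_le_three (m + 1) ω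
    have h2 : S₂.card ≤ 3 := by rw [hS₂]; exact card_fatNbr_le_three (m + 1) ω'
    have : (S₁.card * S₂.card : ℕ) ≤ 9 := Nat.mul_le_mul h1 h2
    exact_mod_cast this
  have hS0 : (0 : ℝ) ≤ S₁.card * S₂.card := by positivity
  obtain ⟨Z, hZdef⟩ : ∃ Z : (Fin 2 → ℝ) → ℝ, Z = fun p => gnCutoff ((π + z) ^ 2 / π ^ 2) ((π + z) ^ 2) (p 0 ^ 2) * gnCutoff ((π + z) ^ 2 / π ^ 2) ((π + z) ^ 2) (p 1 ^ 2) *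
    ((radialCutoffC (1 / 2) (momToComplex p) * ∑ a' ∈ S₁, sectorWeightCirc (m + 1) ((a' : ℕ) : ℤ) (polarAngle p)) *
      (radialCutoffC (1 / 2) (momToComplex p) * ∑ b' ∈ S₂, sectorWeightCirc (m + 1) ((b' : ℕ) : ℤ) (polarAngle p))) := ⟨_, rfl⟩
  have hZ : ∀ p, Z p = gnCutoff ((π + z) ^ 2 / π ^ 2) ((π + z) ^ 2) (p 0 ^ 2) * gnCutoff ((π + z) ^ 2 / π ^ 2) ((π + z) ^ 2) (p 1 ^ 2) *
    ((radialCutoffC (1 / 2) (momToComplex p) * ∑ a' ∈ S₁, sectorWeightCirc (m + 1) ((a' : ℕ) : ℤ) (polarAngle p)) *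
      (radialCutoffC (1 / 2) (momToComplex p) * ∑ b' ∈ S₂, sectorWeightCirc (m + 1) ((b' : ℕ) : ℤ) (polarAngle p))) :=
    fun p => by rw [hZdef]
  obtain ⟨Φ, hΦdef⟩ : ∃ Φ : ℝ × (Fin 2 → ℝ) → ℂ, Φ = fun y => (((bgmCutoffSq e₀ ((16 : ℝ) ^ m * (y.1 ^ 2 + (frameLevel μ K (WithLp.toLp 2 y.2) - ν y.2) ^ 2)) -
      bgmCutoffSq e₀ ((16 : ℝ) ^ m * (y.1 ^ 2 + frameLevel μ K (WithLp.toLp 2 y.2) ^ 2))) *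
      (bgmCutoffSq e₀ ((16 : ℝ) ^ m * (y.1 ^ 2 + frameLevel μ K (WithLp.toLp 2 y.2) ^ 2)) * Z y.2) : ℝ) : ℂ) := ⟨_, rfl⟩
  have hΦ : ∀ k₀ p, Φ (k₀, p) = (((bgmCutoffSq e₀ ((16 : ℝ) ^ m * (k₀ ^ 2 + (frameLevel μ K (WithLp.toLp 2 p) - ν p) ^ 2)) -
      bgmCutoffSq e₀ ((16 : ℝ) ^ m * (k₀ ^ 2 + frameLevel μ K (WithLp.toLp 2 p) ^ 2))) *
      (bgmCutoffSq e₀ ((16 : ℝ) ^ m * (k₀ ^ 2 + frameLevel μ K (WithLp.toLp 2 p) ^ 2)) * Z p) : ℝ) : ℂ) := fun k₀ p => by rw [hΦdef]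
  have hGsΦ : ∀ q, Gs q = Φ (π * (1 - 2 * M) / β + 2 * π / β * (((q.1 0).val : ℕ) : ℝ), fun j => 2 * π / L * (((q.2 j).valMinAbs : ℤ) : ℝ)) := by
    intro q'; rw [hGsdef]
    subst hS₁ hS₂
    exact bgmFatIncr_mul_bgmFat_eq_symbol Ko hA he hz h3 m ω ω' hZ hν hΦ q'
  -- the step and its norms
  set w : Fin 2 → ℝ := fun j => 2 * π / L * (u j : ℝ) with hw
  set η : ℝ := ‖(WithLp.toLp 2 (fun j => 2 * π / L * (u j : ℝ)) : EuclideanSpace ℝ (Fin 2))‖ with hηdef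
  have hη0 : 0 ≤ η := norm_nonneg _
  have hwη : ‖w‖ ≤ η := by
    rw [hηdef, norm_toLp_latticeStep]
    refine (pi_norm_le_iff_of_nonneg (by positivity)).2 fun i => ?_
    rw [hw, Real.norm_eq_abs, abs_mul, abs_of_pos (by positivity : (0:ℝ) < 2 * π / L)]
    refine mul_le_mul_of_nonneg_left (Real.abs_le_sqrt ?_) (by positivity)
    fin_cases i
    · exact le_add_of_nonneg_right (sq_nonneg _)
    · exact le_add_of_nonneg_left (sq_nonneg _)
  have hmc : ‖momToComplex w‖ = η := by
    rw [hηdef, ← norm_momToComplex_ofLp]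
  -- the instance at the step `u`, exact brackets
  obtain ⟨h₁, h₂, h₃⟩ := norm_fwdDiff_iter_space_fatIncrPair_le hA hA3 he hz hz1 hgap h3 m hS₁r hS₂r hd1 hd2 hd3 hd4 hB0 hB hZ hνs hN₀ hN₁ hN₂ hN₃ hΦ hGsΦ
    u hu hw rfl rfl rfl rfl rfl rfl rfl rfl rfl rfl rfl rfl rfl rfl rfl rfl rfl rfl rfl rfl rfl rfl rfl rfl rfl rfl rfl rfl rfl rfl rfl q
  -- the co-factor jets in scale form (actual neighbour count), then relaxed to the count `9`
  have hζ0 : 0 ≤ ζ := by rw [hζ]; have := sectorWidth_pos (m + 1); positivity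
  obtain ⟨bq₁, bq₂, bq₃, h𝔮₁0', h𝔮₂0', h𝔮₃₀0', h𝔮₃₁0'⟩ := incrPair_cofactor_scale_le (g₁ := d * e₀ ^ 2) (g₂ := d * e₀ ^ 4) (g₃ := d * e₀ ^ 6)
    (Λ := klScale e₀ m) (Kp := 4 + 4 * A) (A₃ := A₃) (τw := (4 + 2 * A) * ‖w‖) (nw := ‖w‖) (zD := (1 + 6 * (sectorWidth (m + 1))⁻¹) * ‖momToComplex w‖)
    (S := (S₁.card * S₂.card : ℝ)) (Ba := Ba) (t := t) (η := η) (ζ := ζ) (ε₃₀ := ε₃₀) (ε₃₁ := ε₃₁) (x := x)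
    (by positivity) (by positivity) (by positivity) hΛ (by positivity) hS0 hB0 (by positivity) (norm_nonneg _)
    (by have := sectorWidth_pos (m + 1); positivity)
    (by rw [ht]; positivity) hζ0 hε₃₀ hε₃₁ hx
    (by rw [ht]; exact mul_le_mul_of_nonneg_left hwη (by positivity)) hwη (by rw [hmc, hζ]) hA₃x
    rfl rfl rfl rfl rfl rfl rfl rfl rfl rfl
  have ht0 : 0 ≤ t := by rw [ht]; positivity
  have m𝔮₁ : 2 * (d * e₀ ^ 2) * t / klScale e₀ m + (S₁.card * S₂.card : ℝ) * (12 * Ba * ζ) ≤ 𝔮₁ := by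
    rw [h𝔮₁]
    have a2 : 0 ≤ 12 * Ba * ζ := by positivity
    have := mul_le_mul_of_nonneg_right hS9 a2
    linarith only [this]
  have m𝔮₂ : (4 * (d * e₀ ^ 4) + 2 * (d * e₀ ^ 2)) * t ^ 2 / klScale e₀ m ^ 2 + 2 * (d * e₀ ^ 2) * (4 + 4 * A) / klScale e₀ m +
      4 * (d * e₀ ^ 2) * t / klScale e₀ m * ((S₁.card * S₂.card : ℝ) * (12 * Ba * ζ)) + (S₁.card * S₂.card : ℝ) * ((12 * Ba + 72 * Ba ^ 2) * ζ ^ 2) ≤ 𝔮₂ := by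
    rw [h𝔮₂]
    have a1 : 0 ≤ 4 * (d * e₀ ^ 2) * t / klScale e₀ m := by positivity
    have a2 : 0 ≤ 12 * Ba * ζ := by positivity
    have a3 : 0 ≤ (12 * Ba + 72 * Ba ^ 2) * ζ ^ 2 := by positivity
    have u1 := mul_le_mul_of_nonneg_left (mul_le_mul_of_nonneg_right hS9 a2) a1
    have u2 := mul_le_mul_of_nonneg_right hS9 a3
    linarith only [u1, u2]
  have m𝔮₃₀ : (8 * (d * e₀ ^ 6) + 12 * (d * e₀ ^ 4)) * t ^ 3 / klScale e₀ m ^ 3 + (12 * (d * e₀ ^ 4) + 6 * (d * e₀ ^ 2)) * (t * (4 + 4 * A)) / klScale e₀ m ^ 2 +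
      2 * (d * e₀ ^ 2) * ε₃₀ / klScale e₀ m +
      3 * (((4 * (d * e₀ ^ 4) + 2 * (d * e₀ ^ 2)) * t ^ 2 / klScale e₀ m ^ 2 + 2 * (d * e₀ ^ 2) * (4 + 4 * A) / klScale e₀ m) * ((S₁.card * S₂.card : ℝ) * (12 * Ba * ζ))) +
      3 * (2 * (d * e₀ ^ 2) * t / klScale e₀ m * ((S₁.card * S₂.card : ℝ) * ((12 * Ba + 72 * Ba ^ 2) * ζ ^ 2))) +
      (S₁.card * S₂.card : ℝ) * ((12 * Ba + 216 * Ba ^ 2) * ζ ^ 3) ≤ 𝔮₃₀ := by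
    rw [h𝔮₃₀]
    have a1 : 0 ≤ 3 * ((4 * (d * e₀ ^ 4) + 2 * (d * e₀ ^ 2)) * t ^ 2 / klScale e₀ m ^ 2 + 2 * (d * e₀ ^ 2) * (4 + 4 * A) / klScale e₀ m) := by positivity
    have a2 : 0 ≤ 12 * Ba * ζ := by positivity
    have a3 : 0 ≤ (12 * Ba + 72 * Ba ^ 2) * ζ ^ 2 := by positivity
    have a4 : 0 ≤ (12 * Ba + 216 * Ba ^ 2) * ζ ^ 3 := by positivity
    have a5 : 0 ≤ 3 * (2 * (d * e₀ ^ 2) * t / klScale e₀ m) := by positivity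
    have u1 := mul_le_mul_of_nonneg_left (mul_le_mul_of_nonneg_right hS9 a2) a1
    have u2 := mul_le_mul_of_nonneg_left (mul_le_mul_of_nonneg_right hS9 a3) a5
    have u3 := mul_le_mul_of_nonneg_right hS9 a4
    linarith only [u1, u2, u3]
  have hq₁' := bq₁.trans (mul_le_mul_of_nonneg_left m𝔮₁ hη0)
  have hq₂' := bq₂.trans (mul_le_mul_of_nonneg_left m𝔮₂ (pow_nonneg hη0 2))
  have hq₃' := bq₃.trans (mul_le_mul_of_nonneg_left (add_le_add m𝔮₃₀ (le_of_eq (show 2 * (d * e₀ ^ 2) * ε₃₁ / klScale e₀ m * x = 𝔮₃₁ * x by rw [h𝔮₃₁]))) (pow_nonneg hη0 3))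
  have h𝔮₁0 : 0 ≤ 𝔮₁ := h𝔮₁0'.trans m𝔮₁
  have h𝔮₂0 : 0 ≤ 𝔮₂ := h𝔮₂0'.trans m𝔮₂
  have h𝔮₃₀0 : 0 ≤ 𝔮₃₀ := h𝔮₃₀0'.trans m𝔮₃₀
  have h𝔮₃₁0 : 0 ≤ 𝔮₃₁ := by rw [h𝔮₃₁]; positivity
  -- nonnegativity of the co-factor's actual jets
  have hq₁0 : 0 ≤ 2 * (d * e₀ ^ 2) * ((4 + 2 * A) * ‖w‖) / klScale e₀ m * 1 + 1 * ((S₁.card * S₂.card : ℝ) * (12 * Ba * ((1 + 6 * (sectorWidth (m + 1))⁻¹) * ‖momToComplex w‖))) := by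
    have := sectorWidth_pos (m + 1); positivity
  have hq₂0 : 0 ≤ ((4 * (d * e₀ ^ 4) + 2 * (d * e₀ ^ 2)) * ((4 + 2 * A) * ‖w‖) ^ 2 / klScale e₀ m ^ 2 + 2 * (d * e₀ ^ 2) * ((4 + 4 * A) * ‖w‖ ^ 2) / klScale e₀ m) * 1 +
      4 * (d * e₀ ^ 2) * ((4 + 2 * A) * ‖w‖) / klScale e₀ m * ((S₁.card * S₂.card : ℝ) * (12 * Ba * ((1 + 6 * (sectorWidth (m + 1))⁻¹) * ‖momToComplex w‖))) +
      1 * ((S₁.card * S₂.card : ℝ) * ((12 * Ba + 72 * Ba ^ 2) * ((1 + 6 * (sectorWidth (m + 1))⁻¹) * ‖momToComplex w‖) ^ 2)) := by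
    have := sectorWidth_pos (m + 1); positivity
  -- the algebra
  have hκ0 : 0 ≤ κ := by rw [hκ]; positivity
  have hA30 : 0 ≤ A₃ := (norm_nonneg _).trans (hA3 0)
  obtain ⟨c₁, c₂, c₃, hnn⟩ := incrPair_space_rel_scale_le (Λ := klScale e₀ m) (E₀ := klScale e₀ m + G₀ / x ^ 2) (t := t) (ε₂ := ε₂) (ε₃₀ := ε₃₀) (ε₃₁ := ε₃₁)
    (G₀ := G₀) (G₁ := G₁) (G₂ := G₂) (G₃ := G₃) (η := η) (x := x) (κ := κ) (C₁ := d * e₀ ^ 2 / klScale e₀ m ^ 2)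
    (C₂ := d * e₀ ^ 4 / klScale e₀ m ^ 4) (C₃ := d * e₀ ^ 6 / klScale e₀ m ^ 6) (C₄ := d * e₀ ^ 8 / klScale e₀ m ^ 8)
    (E₁ := (4 + 2 * A) * ‖w‖) (E₂ := (4 + 4 * A) * ‖w‖ ^ 2) (E₃ := (4 + 8 * A₃) * ‖w‖ ^ 3)
    (P₀ := G₀ / x ^ 2) (P₁ := G₁ / x * ‖w‖) (P₂ := G₂ * ‖w‖ ^ 2) (P₃ := G₃ * x * ‖w‖ ^ 3)
    hΛ (le_add_of_nonneg_right (by positivity)) (by linarith only [hGΛ]) ht0 (by rw [hε₂]; positivity) hε₃₀ hε₃₁ hG₀ hG₁ hG₂ hG₃ hη0 hx hκ0 (by positivity)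
    (by positivity) (by positivity) (by positivity) (by positivity) (by positivity) (by positivity)
    (by rw [ht]; exact mul_le_mul_of_nonneg_left hwη (by positivity))
    (by rw [hε₂]; exact mul_le_mul_of_nonneg_left (pow_le_pow_left₀ (norm_nonneg _) hwη 2) (by positivity))
    (mul_le_mul hA₃x (pow_le_pow_left₀ (norm_nonneg _) hwη 3) (by positivity) (by positivity))
    rfl (mul_le_mul_of_nonneg_left hwη (by positivity)) (mul_le_mul_of_nonneg_left (pow_le_pow_left₀ (norm_nonneg _) hwη 2) hG₂)
    (mul_le_mul_of_nonneg_left (pow_le_pow_left₀ (norm_nonneg _) hwη 3) (by positivity))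
    (by rw [hκ]; field_simp) (by rw [hκ]; field_simp) (by rw [hκ]; field_simp)
    rfl rfl rfl rfl rfl rfl rfl rfl rfl rfl rfl h₁ h₂ h₃ hq₁0 hq₂0 hq₁' hq₂' hq₃' h𝔮₁0 h𝔮₂0 h𝔮₃₀0 h𝔮₃₁0
    hd₁ hw₁ hd₂ hw₂ hd₃₀ hd₃₁ hw₃₀ hw₃₁ ho₁₀ ho₁₁ ho₂₀ ho₂₁ ho₂₂ ho₃₀ ho₃₁ ho₃₂ ho₃₃ hR₁₀ hR₁₁ hR₂₀ hR₂₁ hR₂₂ hR₃₀ hR₃₁ hR₃₂ hR₃₃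
    hr₁₀ hr₁₁ hr₂₀ hr₂₁ hr₂₂ hr₃₀ hr₃₁ hr₃₂ hr₃₃
  rw [← hC₁, ← hB₀x] at c₁ c₂ c₃
  exact ⟨c₁, c₂, c₃, hnn⟩

end IsoScale

end Summit.HubbardSuperconductivity.HubbardSuperconductivity.Theorems.TorusFourierL2

end
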